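import Mathlib
import HarnessLib
import Summits.Ventures.LatticeQCDFlow.Exactness.NCMCGeneralSpaceOverlap

/-!
# When do the diagnostics saturate?  Zero mean dissipation, unit ESS and sure acceptance all single out the dissipation-free protocols

HONEST FRAMING: exact (Metropolis-corrected) sampling algorithms for lattice gauge theory;
figures of merit are autocorrelation/cost numbers at stated couplings and volumes; no
continuum-physics claim.

Venture `LatticeQCDFlow` (cell pub-lqcd), topic `Exactness`; FANOUT row 13 (`eng-snf`, GEN-11).
NEW WORK of the cell (general measure theory, elementary), not a published result; nothing is
cited as a fact.  General-state-space counterpart, for an arbitrary Crooks pair, of the saturation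
half of row 19's finite `Exactness/SampleESS.lean` (`essHat_eq_one_iff`: the SAMPLE Kish fraction is
one iff all weights coincide — the planted-control signature `V2:logw-constant` / INVALID-3) and of
`NCMCGeneralSpaceOverlap.accept_eq_one_iff`; setting of `NCMCGeneralSpaceDissipation.lean` /
`NCMCGeneralSpaceRelativeEntropy.lean` / `NCMCGeneralSpaceOverlap.lean`: a Crooks pair from `ν₀` to
`ν₁`, `P_F`, `P_R`, `e^{−ΔF} = Z₁/Z₀`.

## Content

The three run-time diagnostics of a two-sided non-equilibrium run — mean dissipated work
`⟨W_d⟩_F = E_{P_F}[W] − ΔF`, population ESS `ESS_F = (E_F e^{−W})² / E_F e^{−2W}`, switch acceptance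
`acc(ΔF) = E_{P_F}[min(1, e^{−(W−ΔF)})]` — each take their ideal value on exactly the same protocols:

* **`CrooksPair.integral_work_eq_freeEnergyDiff_iff`** — for an integrable work,
  `E_{P_F}[W] = ΔF ↔ P_F = P_R` (`KL(P_F‖P_R) = E_F[W] − ΔF` and Mathlib's `klDiv_eq_zero_iff`);
  `integral_work_rev_eq_freeEnergyDiff_iff` — the same for the reverse lane.
* **`CrooksPair.essPop_eq_one_iff`** — for `e^{−W} ∈ L²(P_F)`, `ESS_F = 1 ↔ W = ΔF` `P_F`-a.s.
  (equality in Cauchy–Schwarz: zero variance of the Jarzynski weight, Mathlib `evariance_eq_zero_iff`);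
  `essPop_eq_one_iff_fwd_eq_rev` — `↔ P_F = P_R`.
* `CrooksPair.essPop_eq_one_iff_accept_eq_one`, `integral_work_eq_freeEnergyDiff_iff_accept_eq_one`
  — hence `ESS_F = 1 ↔ acc(ΔF) = 1 ↔ ⟨W_d⟩_F = 0`, all equivalent to `W = ΔF` almost surely
  (`NCMCGeneralSpaceRelativeEntropy.fwdPathLaw_eq_revPathLaw_iff`): in population an honest run
  reports a saturated diagnostic only for a dissipation-free protocol, for adjoint stochastic steps,
  Jacobian-charged layers and their concatenations alike.

Nothing is claimed about finite-sample fluctuations of the reported numbers around these values.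
-/

namespace Summit.Ventures.LatticeQCDFlow.Exactness.GeneralNCMC

open MeasureTheory ProbabilityTheory Set Filter InformationTheory
open scoped ENNReal

variable {Ω E : Type*} [MeasurableSpace Ω] [MeasurableSpace E]

namespace CrooksPair

variable {ν₀ ν₁ : Measure Ω} {κF κR : Kernel Ω E} {s e : E → Ω} {W : E → ℝ}

/-! ## Zero mean dissipation -/

/-- **`E_{P_F}[W] = ΔF ↔ P_F = P_R`** for a `P_F`-integrable work: the forward lane's mean dissipated
work vanishes exactly for the dissipation-free protocols (`KL(P_F‖P_R) = E_F[W] − ΔF ≥ 0` with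
equality iff the laws coincide). -/
theorem integral_work_eq_freeEnergyDiff_iff [IsFiniteMeasure ν₀] [IsFiniteMeasure ν₁]
    [IsMarkovKernel κF] [IsMarkovKernel κR] (h0 : ν₀ univ ≠ 0) (h1 : ν₁ univ ≠ 0)
    (h : CrooksPair ν₀ ν₁ κF κR s e W) {ΔF : ℝ}
    (hΔF : Real.exp (-ΔF) = ((ν₀ univ)⁻¹ * ν₁ univ).toReal) (hW : Integrable W (fwdPathLaw ν₀ κF)) :
    ∫ ε, W ε ∂(fwdPathLaw ν₀ κF) = ΔF ↔ fwdPathLaw ν₀ κF = fwdPathLaw ν₁ κR := by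
  haveI := isProbabilityMeasure_fwdPathLaw ν₀ h0 κF
  haveI := isProbabilityMeasure_fwdPathLaw ν₁ h1 κR
  have hsl := h.freeEnergyDiff_le_integral_work h0 hΔF hW
  rw [← klDiv_eq_zero_iff, h.klDiv_fwd_rev_of_integrable h0 h1 hΔF hW, ENNReal.ofReal_eq_zero]
  constructor
  · intro heq
    rw [heq, sub_self]
  · intro hle
    linarith

/-- **`E_{P_R}[W] = ΔF ↔ P_F = P_R`** for a `P_R`-integrable work (the reverse lane). -/
theorem integral_work_rev_eq_freeEnergyDiff_iff [IsFiniteMeasure ν₀] [IsFiniteMeasure ν₁]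
    [IsMarkovKernel κF] [IsMarkovKernel κR] (h0 : ν₀ univ ≠ 0) (h1 : ν₁ univ ≠ 0)
    (h : CrooksPair ν₀ ν₁ κF κR s e W) {ΔF : ℝ}
    (hΔF : Real.exp (-ΔF) = ((ν₀ univ)⁻¹ * ν₁ univ).toReal) (hW : Integrable W (fwdPathLaw ν₁ κR)) :
    ∫ ε, W ε ∂(fwdPathLaw ν₁ κR) = ΔF ↔ fwdPathLaw ν₀ κF = fwdPathLaw ν₁ κR := by
  have hs := h.symm.integral_work_eq_freeEnergyDiff_iff h1 h0 (exp_freeEnergyDiff h0 h1 hΔF) hW.neg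
  rw [integral_neg, neg_inj] at hs
  rw [hs]
  exact eq_comm

/-! ## Unit ESS -/

/-- **`ESS_F = 1 ↔ W = ΔF` almost surely** (Jarzynski weight in `L²(P_F)`): the population Kish ESS
`(E_F e^{−W})² / E_F e^{−2W}` equals one exactly when the weight is a.s. constant — equality in
Cauchy–Schwarz — and that constant is `e^{−ΔF}` by Jarzynski.  Population form of
`SampleESS.essHat_eq_one_iff`. -/
theorem essPop_eq_one_iff [IsFiniteMeasure ν₀] [IsMarkovKernel κF] [IsMarkovKernel κR]
    (h0 : ν₀ univ ≠ 0) (h : CrooksPair ν₀ ν₁ κF κR s e W) {ΔF : ℝ}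
    (hΔF : Real.exp (-ΔF) = ((ν₀ univ)⁻¹ * ν₁ univ).toReal)
    (hL2 : MemLp (fun ε => Real.exp (-W ε)) 2 (fwdPathLaw ν₀ κF)) :
    (∫ ε, Real.exp (-W ε) ∂(fwdPathLaw ν₀ κF)) ^ 2 /
        ∫ ε, Real.exp (-(2 * W ε)) ∂(fwdPathLaw ν₀ κF) = 1 ↔
      ∀ᵐ ε ∂(fwdPathLaw ν₀ κF), W ε = ΔF := by
  haveI := isProbabilityMeasure_fwdPathLaw ν₀ h0 κF
  set μ := fwdPathLaw ν₀ κF with hμ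
  set X : E → ℝ := fun ε => Real.exp (-W ε) with hX
  have hXm : AEMeasurable X μ := hL2.aestronglyMeasurable.aemeasurable
  have hmean : ∫ ε, X ε ∂μ = Real.exp (-ΔF) := by rw [hX, hμ, h.integral_exp_neg_work, hΔF]
  -- the second moment in the two spellings
  have hsq : ∫ ε, Real.exp (-(2 * W ε)) ∂μ = μ[X ^ 2] := by
    refine integral_congr_ae (Eventually.of_forall fun ε => ?_)
    simp only [hX, Pi.pow_apply]
    rw [sq, ← Real.exp_add]
    congr 1
    ring
  have hm2pos : 0 < μ[X ^ 2] := by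
    have : (fun ε => (X ^ 2) ε) = fun ε => Real.exp (-(2 * W ε)) := by
      funext ε
      simp only [hX, Pi.pow_apply]
      rw [sq, ← Real.exp_add]
      congr 1
      ring
    rw [show μ[X ^ 2] = ∫ ε, Real.exp (-(2 * W ε)) ∂μ from hsq.symm]
    refine integral_exp_pos ?_
    have hi := hL2.integrable_sq
    exact hi.congr (Eventually.of_forall fun ε => by
      simp only [hX]
      rw [sq, ← Real.exp_add]
      congr 1
      ring)
  -- `ESS = 1 ↔ Var = 0`
  have hvar : variance X μ = μ[X ^ 2] - (∫ ε, X ε ∂μ) ^ 2 := variance_eq_sub hL2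
  rw [hsq, div_eq_one_iff_eq hm2pos.ne']
  -- `Var = 0 ↔ X = E X` a.s.
  have hev : variance X μ = 0 ↔ X =ᵐ[μ] fun _ => ∫ ε, X ε ∂μ := by
    rw [← evariance_eq_zero_iff hXm, variance, ENNReal.toReal_eq_zero_iff,
      or_iff_left (hL2.evariance_lt_top).ne]
  constructor
  · intro hE
    have hv0 : variance X μ = 0 := by rw [hvar, hE, sub_self]
    filter_upwards [hev.1 hv0] with ε hε
    rw [hmean] at hε
    have := Real.exp_injective hε
    linarith
  · intro hae
    have hv0 : variance X μ = 0 := by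
      refine hev.2 ?_
      filter_upwards [hae] with ε hε
      rw [hmean, hX]
      simp only [hε]
    rw [hvar] at hv0
    linarith

/-- **`ESS_F = 1 ↔ P_F = P_R`.** -/
theorem essPop_eq_one_iff_fwd_eq_rev [IsFiniteMeasure ν₀] [IsFiniteMeasure ν₁] [IsMarkovKernel κF]
    [IsMarkovKernel κR] (h0 : ν₀ univ ≠ 0) (h1 : ν₁ univ ≠ 0) (h : CrooksPair ν₀ ν₁ κF κR s e W)
    (hL2 : MemLp (fun ε => Real.exp (-W ε)) 2 (fwdPathLaw ν₀ κF)) :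
    (∫ ε, Real.exp (-W ε) ∂(fwdPathLaw ν₀ κF)) ^ 2 /
        ∫ ε, Real.exp (-(2 * W ε)) ∂(fwdPathLaw ν₀ κF) = 1 ↔
      fwdPathLaw ν₀ κF = fwdPathLaw ν₁ κR := by
  have hΔF := exp_neg_freeEnergyDiff (ν₀ := ν₀) (ν₁ := ν₁) h0 h1
  rw [h.essPop_eq_one_iff h0 hΔF hL2, h.fwdPathLaw_eq_revPathLaw_iff h0 h1 hΔF]

/-! ## All three diagnostics saturate together -/

/-- **`ESS_F = 1 ↔ acc(ΔF) = 1`**: unit population ESS and sure acceptance of the Metropolized switch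
at `c = ΔF` are the same event on protocols (both `↔ P_F = P_R`). -/
theorem essPop_eq_one_iff_accept_eq_one [IsFiniteMeasure ν₀] [IsFiniteMeasure ν₁] [IsMarkovKernel κF]
    [IsMarkovKernel κR] (h0 : ν₀ univ ≠ 0) (h1 : ν₁ univ ≠ 0) (h : CrooksPair ν₀ ν₁ κF κR s e W)
    {ΔF : ℝ} (hΔF : Real.exp (-ΔF) = ((ν₀ univ)⁻¹ * ν₁ univ).toReal)
    (hL2 : MemLp (fun ε => Real.exp (-W ε)) 2 (fwdPathLaw ν₀ κF)) :
    (∫ ε, Real.exp (-W ε) ∂(fwdPathLaw ν₀ κF)) ^ 2 /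
        ∫ ε, Real.exp (-(2 * W ε)) ∂(fwdPathLaw ν₀ κF) = 1 ↔
      ∫ ε, min 1 (Real.exp (-(W ε - ΔF))) ∂(fwdPathLaw ν₀ κF) = 1 := by
  rw [h.essPop_eq_one_iff_fwd_eq_rev h0 h1 hL2, h.accept_eq_one_iff h0 h1 hΔF]

/-- **`⟨W_d⟩_F = 0 ↔ acc(ΔF) = 1`** for an integrable work: zero mean dissipation and sure acceptance
coincide as well. -/
theorem integral_work_eq_freeEnergyDiff_iff_accept_eq_one [IsFiniteMeasure ν₀] [IsFiniteMeasure ν₁]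
    [IsMarkovKernel κF] [IsMarkovKernel κR] (h0 : ν₀ univ ≠ 0) (h1 : ν₁ univ ≠ 0)
    (h : CrooksPair ν₀ ν₁ κF κR s e W) {ΔF : ℝ}
    (hΔF : Real.exp (-ΔF) = ((ν₀ univ)⁻¹ * ν₁ univ).toReal) (hW : Integrable W (fwdPathLaw ν₀ κF)) :
    ∫ ε, W ε ∂(fwdPathLaw ν₀ κF) = ΔF ↔
      ∫ ε, min 1 (Real.exp (-(W ε - ΔF))) ∂(fwdPathLaw ν₀ κF) = 1 := by
  rw [h.integral_work_eq_freeEnergyDiff_iff h0 h1 hΔF hW, h.accept_eq_one_iff h0 h1 hΔF]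

/-- **`⟨W_d⟩_F = 0 ↔ W = ΔF` almost surely** (integrable work): a vanishing MEAN dissipation already
forces every single evolution to be dissipation-free. -/
theorem integral_work_eq_freeEnergyDiff_iff_ae [IsFiniteMeasure ν₀] [IsFiniteMeasure ν₁]
    [IsMarkovKernel κF] [IsMarkovKernel κR] (h0 : ν₀ univ ≠ 0) (h1 : ν₁ univ ≠ 0)
    (h : CrooksPair ν₀ ν₁ κF κR s e W) {ΔF : ℝ}
    (hΔF : Real.exp (-ΔF) = ((ν₀ univ)⁻¹ * ν₁ univ).toReal) (hW : Integrable W (fwdPathLaw ν₀ κF)) :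
    ∫ ε, W ε ∂(fwdPathLaw ν₀ κF) = ΔF ↔ ∀ᵐ ε ∂(fwdPathLaw ν₀ κF), W ε = ΔF := by
  rw [h.integral_work_eq_freeEnergyDiff_iff h0 h1 hΔF hW, h.fwdPathLaw_eq_revPathLaw_iff h0 h1 hΔF]

end CrooksPair

end Summit.Ventures.LatticeQCDFlow.Exactness.GeneralNCMC
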